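import Summits.BirchSwinnertonDyer.BirchSwinnertonDyer.Theses.AdditiveKolyvaginRoad
import Summits.BirchSwinnertonDyer.BirchSwinnertonDyer.Theorems.AdditiveKolyvaginRoadManinFrameFromDatum
import HarnessLib

/-!
# Route `AdditiveKolyvaginRoad`, support item `ManinFrameIstarClass`
# (stmt-BirchSwinnertonDyer-20093): Manin-good odd Heegner frames at an additive prime `p ≥ 5`
# for a class of Kodaira type `Iₙ*` at `p` — the Mazur–Stevens twin of `X11b.exists_oddHeegnerData`

Cell `pub/bsd-wall` (D-0120, W-ALL lane 3, row 2), seat `bsd-wall-akr-p2` (prover). THEOREMS ONLY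
(no definition, no named fact, no `sorry`); nothing is booked.

WHAT THE ITEM ASKS. From Mazur 1978 Cor. 4.1, Abbes–Ullmo 1996 Thm. A and Česnavičius 2018 Thm. 1.2
in their tree renderings BY NAME (`MazurManinConstantOddPrimes` = `mazur_not_dvd_maninConstant_of_odd`,
`AbbesUllmoManinConstantGoodPrimes` = `abbesUllmo_not_dvd_maninConstant_of_not_dvd_level`,
`CesnaviciusManinConstantAtTwo` = `cesnavicius_not_two_dvd_maninConstant_of_two_dvd_level`) and
`PublishedInputsAdditiveKoly` (only Modularity `hnf` = conjunct 6 and Hoffstein–Luo `hHL` =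
conjunct 7 are used): at every additive `p ≥ 5` with `E[p]` irreducible and `r_an = 1`, for a
curve `W` whose WHOLE `ℚ`-isogeny class has Kodaira type `Iₙ*` (some `n ≥ 0`, member by member) at
the place of `ℤ` under `p`, the frame of `ManinGoodOddFrameAdditive` exists: a Hoffstein–Luo field
`K`, a parametrisation datum `Dt` of `W` at level `N` with `p ∤ c(Dt)`, its Heegner point
`P ∈ E(K)`, and a minimal model of the twist `E^{(d_K)}`. The primes `p ∈ {5, 7}` ARE included.

PROOF = `AdditiveKolyvaginRoadManinFrameFromDatum.lean` (route-independent, this seat):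
`exists_modularParametrizationData_not_dvd_of_istarClass` (the datum with `p ∤ c`: optimal curve
`W₀ ∼ W`, the tree theorem `not_dvd_maninConstant_of_kodairaSymbolAt_eq_Istar` at `W₀` — the class
hypothesis is read at `W₀` —, prime-to-`p` transport under `Irr`) fed to
`exists_oddHeegnerFrame_of_exists_not_dvd` (Hoffstein–Luo field, Darmon Thm. 3.6 point, minimal
model of the twist). `Addv W p` is not used (type `Iₙ*` is additive anyway) and `5 ≤ p` only as
`p ≠ 2`.

WHY THE CLASS QUANTIFIER (planner rev 5): the Manin theorem's hypothesis is about `W₀`; "type `Iₙ*`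
at `p`" is a `ℚ`-isogeny invariant under `Irr` in print (Dokchitser–Dokchitser 2015, Table 1), not
yet inside the tree, so the item quantifies over the class and this file proves it as filed.

References: [EdixhovenManin1991] §1 (typescript L96–101); [Stevens1989] Lemmas (5.2), (5.4);
[Mazur1978] Cor. 4.1; [AbbesUllmo1996] Thm. A; [Cesnavicius2018] Thm. 1.2; [HoffsteinLuo1997]
Theorem (§1); [Darmon2004] Thm. 3.6.
-/

set_option autoImplicit false
-- the Theorems directory repeats the summit name (sibling precedent `SignedBaseChangeAssembly.lean`)
set_option linter.dupNamespace false

noncomputable section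

open scoped Classical

open WeierstrassCurve Literature.NumberTheory.EllipticCurves.Rank1Residual
  Summit.BirchSwinnertonDyer.BirchSwinnertonDyer.Theorems.ManinFrameFromDatum

namespace Summit.BirchSwinnertonDyer.BirchSwinnertonDyer.Theorems.ManinFrameIstarClass

open Summit.BirchSwinnertonDyer.BirchSwinnertonDyer.Theses.AdditiveKolyvaginRoad in
/-- **`ManinFrameIstarClass` (item stmt-BirchSwinnertonDyer-20093) — the route decl BY NAME,
unconditional**: `hM`, `hAU`, `hC2` are the decl's first three hypotheses (rfl-equal to the cited
kernels), `hnf`, `hHL` are conjuncts 6 and 7 of `PublishedInputsAdditiveKoly`, the class hypothesis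
is `hIstT` of `exists_modularParametrizationData_not_dvd_of_istarClass`, and the frame is
`exists_oddHeegnerFrame_of_exists_not_dvd`; `Addv W p` is not used (type `Iₙ*` is additive anyway)
and `5 ≤ p` only as `p ≠ 2`. [cite: EdixhovenManin1991, §1 (typescript L96–101)]
[cite: Stevens1989, Lemmas (5.2), (5.4)] [cite: HoffsteinLuo1997, Theorem (§1)] [cite: Darmon2004, Thm. 3.6] -/
theorem maninFrameIstarClass_proof : ManinFrameIstarClass := by
  intro hM hAU hC2 hPub W _ _ p _ _ hp5 _ hirr hIstT hr
  exact exists_oddHeegnerFrame_of_exists_not_dvd hPub.2.2.2.2.2.1 hPub.2.2.2.2.2.2.1 W p hr (by omega)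
    (exists_modularParametrizationData_not_dvd_of_istarClass hPub.2.2.2.2.2.1 hM hAU hC2 W rfl p
      (by omega) hirr (fun W₀ _ _ hiso ↦ hIstT W₀ hiso))

end Summit.BirchSwinnertonDyer.BirchSwinnertonDyer.Theorems.ManinFrameIstarClass

end
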